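import Summits.CriticalPhenomena.PercolationContinuityZ3.Theses.PercNonProliferation
import Literature.Probability.Percolation.SharpnessDCTProofs
import Literature.Probability.Percolation.SlabCriticality
import Literature.Probability.Percolation.SeedLemma

/-!
# Crux `PercNonProliferation.FreeBoxSparse` (stmt-CriticalPhenomena-4445), line `ccfs-window-kissing-walls` —
# the density/pair-sum Markov inequality (lead's helper)

For a finite `Λ ⊂ ℤ³`, a configuration `ω`, and the FREE pieces `C_Λ(x) = {v ∈ Λ | ω ∈ openConnIn ↑Λ x v}`
(components of the open subgraph induced on `Λ`):

* `sq_card_piece_le_pairCount` (pointwise): `|C_Λ(x₀)|² ≤ #{(x,y) ∈ Λ² : x ↔ y inside Λ}` — every two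
  points of one piece are joined inside `Λ`;
* `real_exists_dense_mul_le_pairSum` (Markov): `δ²|Λ|² · P_p(∃ x ∈ Λ, |C_Λ(x)| ≥ δ|Λ|) ≤ Σ_{x,y∈Λ} P_p(x ↔ y inside Λ)`.

So the free pair average `FA₂` controls the probability of a `δ`-dense free piece: `P(δ-dense piece) ≤ FA₂/δ²`.
This is the bridge between the crux `FreeBoxSparse` (`FA₂(p_c, n) → 0`) and the density language of the line's
stubs (`bothDense`, `unglued`, …); in particular it shows that the residual stub `stub_corridor` is implied by the
crux (its hypothesis "giant scale" fails eventually and its conclusion event asks for dense pieces).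
-/

noncomputable section

namespace Summit.CriticalPhenomena.PercolationContinuityZ3.Theorems.FreeBoxSparse

open MeasureTheory Filter
open Literature.Probability.Percolation Literature.Probability.LatticeModels
open scoped Topology Classical

/-- Two points of the free piece of `x₀` in `Λ` are joined inside `Λ`. [folklore] -/
theorem mem_openConnIn_of_mem_piece {Λ : Finset (Site 3)} {ω : BondConfig (Site 3)} {x₀ x y : Site 3}
    (hx : ω ∈ openConnIn (↑Λ : Set (Site 3)) x₀ x) (hy : ω ∈ openConnIn (↑Λ : Set (Site 3)) x₀ y) :
    ω ∈ openConnIn (↑Λ : Set (Site 3)) x y :=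
  GM.openConnIn_trans (openConnIn_reverse hx) hy

/-- **Pointwise**: the square of the size of any free piece is at most the number of pairs of `Λ`
joined inside `Λ`: `|C_Λ(x₀)|² ≤ #{(x,y) ∈ Λ × Λ : ω ∈ openConnIn ↑Λ x y}`. [folklore] -/
theorem sq_card_piece_le_pairCount (Λ : Finset (Site 3)) (ω : BondConfig (Site 3)) (x₀ : Site 3) :
    ((Λ.filter fun v => ω ∈ openConnIn (↑Λ : Set (Site 3)) x₀ v).card) ^ 2 ≤
      ((Λ ×ˢ Λ).filter fun q => ω ∈ openConnIn (↑Λ : Set (Site 3)) q.1 q.2).card := by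
  set P := Λ.filter fun v => ω ∈ openConnIn (↑Λ : Set (Site 3)) x₀ v with hP
  have hsub : P ×ˢ P ⊆ (Λ ×ˢ Λ).filter fun q => ω ∈ openConnIn (↑Λ : Set (Site 3)) q.1 q.2 := by
    intro q hq
    rw [Finset.mem_product] at hq
    rw [hP, Finset.mem_filter, Finset.mem_filter] at hq
    rw [Finset.mem_filter, Finset.mem_product]
    exact ⟨⟨hq.1.1, hq.2.1⟩, mem_openConnIn_of_mem_piece hq.1.2 hq.2.2⟩
  calc P.card ^ 2 = (P ×ˢ P).card := by rw [Finset.card_product, sq]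
    _ ≤ _ := Finset.card_le_card hsub

/-- The pair count as a double sum of indicators. [folklore] -/
theorem pairCount_eq_sum_indicator (Λ : Finset (Site 3)) (ω : BondConfig (Site 3)) :
    (((Λ ×ˢ Λ).filter fun q => ω ∈ openConnIn (↑Λ : Set (Site 3)) q.1 q.2).card : ℝ) =
      ∑ x ∈ Λ, ∑ y ∈ Λ, (openConnIn (↑Λ : Set (Site 3)) x y).indicator (1 : BondConfig (Site 3) → ℝ) ω := by
  rw [Finset.card_filter, Nat.cast_sum, Finset.sum_product]
  refine Finset.sum_congr rfl fun x _ => Finset.sum_congr rfl fun y _ => ?_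
  by_cases h : ω ∈ openConnIn (↑Λ : Set (Site 3)) x y
  · simp [h]
  · simp [h]

/-- The event "`Λ` has a `δ`-dense free piece" is measurable. [folklore] -/
theorem measurableSet_exists_dense (Λ : Finset (Site 3)) (δ : ℝ) :
    MeasurableSet {ω : BondConfig (Site 3) | ∃ x ∈ Λ,
      δ * (Λ.card : ℝ) ≤ (((Λ.filter fun v => ω ∈ openConnIn (↑Λ : Set (Site 3)) x v)).card : ℝ)} := by
  have hmeas : ∀ x : Site 3, Measurable fun ω : BondConfig (Site 3) =>
      (((Λ.filter fun v => ω ∈ openConnIn (↑Λ : Set (Site 3)) x v)).card : ℝ) := by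
    intro x
    have heq : (fun ω : BondConfig (Site 3) =>
        (((Λ.filter fun v => ω ∈ openConnIn (↑Λ : Set (Site 3)) x v)).card : ℝ)) =
        fun ω => ∑ v ∈ Λ, (openConnIn (↑Λ : Set (Site 3)) x v).indicator (1 : BondConfig (Site 3) → ℝ) ω := by
      funext ω
      rw [Finset.card_filter, Nat.cast_sum]
      refine Finset.sum_congr rfl fun v _ => ?_
      by_cases h : ω ∈ openConnIn (↑Λ : Set (Site 3)) x v
      · simp [h]
      · simp [h]
    rw [heq]
    refine Finset.measurable_sum _ fun v _ => ?_
    exact (measurable_const.indicator (DCT16.measurableSet_openConnIn Λ x v))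
  have : {ω : BondConfig (Site 3) | ∃ x ∈ Λ,
      δ * (Λ.card : ℝ) ≤ (((Λ.filter fun v => ω ∈ openConnIn (↑Λ : Set (Site 3)) x v)).card : ℝ)} =
      ⋃ x ∈ Λ, {ω | δ * (Λ.card : ℝ) ≤ (((Λ.filter fun v => ω ∈ openConnIn (↑Λ : Set (Site 3)) x v)).card : ℝ)} := by
    ext ω; simp
  rw [this]
  exact MeasurableSet.biUnion (Finset.countable_toSet Λ) fun x _ => measurableSet_le measurable_const (hmeas x)

/-- **Markov inequality for dense free pieces**: `δ²|Λ|² · P_p(∃ x ∈ Λ, |C_Λ(x)| ≥ δ|Λ|) ≤ Σ_{x,y∈Λ} P_p(x ↔ y inside Λ)`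
(`δ ≥ 0`). On the event, the pair count is at least `|C_Λ(x)|² ≥ δ²|Λ|²` (`sq_card_piece_le_pairCount`); integrate.
Hence `P(Λ has a δ-dense free piece) ≤ FA₂(Λ)/δ²`. [folklore] -/
theorem real_exists_dense_mul_le_pairSum (p : unitInterval) (Λ : Finset (Site 3)) {δ : ℝ} (hδ : 0 ≤ δ) :
    δ ^ 2 * ((Λ.card : ℝ)) ^ 2 *
        (bondPercolation (zdGraph 3) p).real {ω | ∃ x ∈ Λ,
          δ * (Λ.card : ℝ) ≤ (((Λ.filter fun v => ω ∈ openConnIn (↑Λ : Set (Site 3)) x v)).card : ℝ)} ≤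
      ∑ x ∈ Λ, ∑ y ∈ Λ, (bondPercolation (zdGraph 3) p).real (openConnIn (↑Λ : Set (Site 3)) x y) := by
  set μ := bondPercolation (zdGraph 3) p with hμ
  set D := {ω : BondConfig (Site 3) | ∃ x ∈ Λ,
      δ * (Λ.card : ℝ) ≤ (((Λ.filter fun v => ω ∈ openConnIn (↑Λ : Set (Site 3)) x v)).card : ℝ)} with hD
  have hDm : MeasurableSet D := measurableSet_exists_dense Λ δ
  set g : BondConfig (Site 3) → ℝ := fun ω =>
      ∑ x ∈ Λ, ∑ y ∈ Λ, (openConnIn (↑Λ : Set (Site 3)) x y).indicator (1 : BondConfig (Site 3) → ℝ) ω with hg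
  have hAm : ∀ x y : Site 3, MeasurableSet (openConnIn (↑Λ : Set (Site 3)) x y) :=
    fun x y => DCT16.measurableSet_openConnIn Λ x y
  have hint : ∀ x y : Site 3, Integrable
      (fun ω => (openConnIn (↑Λ : Set (Site 3)) x y).indicator (1 : BondConfig (Site 3) → ℝ) ω) μ :=
    fun x y => (integrable_const (1 : ℝ)).indicator (hAm x y)
  have hgint : Integrable g μ :=
    integrable_finsetSum _ fun x _ => integrable_finsetSum _ fun y _ => hint x y
  -- lower bound on `D`
  have hlow : ∀ ω ∈ D, δ ^ 2 * ((Λ.card : ℝ)) ^ 2 ≤ g ω := by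
    intro ω hω
    obtain ⟨x₀, -, hx₀⟩ := hω
    set a : ℕ := (Λ.filter fun v => ω ∈ openConnIn (↑Λ : Set (Site 3)) x₀ v).card with ha
    set b : ℕ := ((Λ ×ˢ Λ).filter fun q => ω ∈ openConnIn (↑Λ : Set (Site 3)) q.1 q.2).card with hb
    have h1 : a ^ 2 ≤ b := sq_card_piece_le_pairCount Λ ω x₀
    have h1' : ((a : ℝ)) ^ 2 ≤ (b : ℝ) := by exact_mod_cast h1
    have h0 : 0 ≤ δ * (Λ.card : ℝ) := by positivity
    have hb' : (b : ℝ) = g ω := pairCount_eq_sum_indicator Λ ω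
    calc δ ^ 2 * ((Λ.card : ℝ)) ^ 2 = (δ * (Λ.card : ℝ)) ^ 2 := by ring
      _ ≤ ((a : ℝ)) ^ 2 := pow_le_pow_left₀ h0 hx₀ 2
      _ ≤ (b : ℝ) := h1'
      _ = g ω := hb'
  -- integrate over `D`
  have hstep1 : δ ^ 2 * ((Λ.card : ℝ)) ^ 2 * μ.real D ≤ ∫ ω in D, g ω ∂μ :=
    setIntegral_ge_of_const_le_real hDm (measure_ne_top _ _) hlow hgint.integrableOn
  have hstep2 : ∫ ω in D, g ω ∂μ ≤ ∫ ω, g ω ∂μ := by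
    refine setIntegral_le_integral hgint (Eventually.of_forall fun ω => ?_)
    exact Finset.sum_nonneg fun x _ => Finset.sum_nonneg fun y _ => Set.indicator_nonneg (fun _ _ => zero_le_one) _
  have hstep3 : ∫ ω, g ω ∂μ = ∑ x ∈ Λ, ∑ y ∈ Λ, μ.real (openConnIn (↑Λ : Set (Site 3)) x y) := by
    rw [hg, integral_finsetSum _ fun x _ => integrable_finsetSum _ fun y _ => hint x y]
    refine Finset.sum_congr rfl fun x _ => ?_
    rw [integral_finsetSum _ fun y _ => hint x y]
    refine Finset.sum_congr rfl fun y _ => ?_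
    exact integral_indicator_one (hAm x y)
  linarith

/-- **Corollary**: for nonempty `Λ` and `δ > 0`,
`P_p(∃ δ-dense free piece in Λ) ≤ (Σ_{x,y∈Λ} P_p(x ↔ y inside Λ) / |Λ|²) / δ²`. [folklore] -/
theorem real_exists_dense_le_pairAverage_div (p : unitInterval) {Λ : Finset (Site 3)} (hΛ : Λ.Nonempty)
    {δ : ℝ} (hδ : 0 < δ) :
    (bondPercolation (zdGraph 3) p).real {ω | ∃ x ∈ Λ,
        δ * (Λ.card : ℝ) ≤ (((Λ.filter fun v => ω ∈ openConnIn (↑Λ : Set (Site 3)) x v)).card : ℝ)} ≤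
      ((∑ x ∈ Λ, ∑ y ∈ Λ, (bondPercolation (zdGraph 3) p).real (openConnIn (↑Λ : Set (Site 3)) x y)) /
        ((Λ.card : ℝ)) ^ 2) / δ ^ 2 := by
  have hc : (0 : ℝ) < Λ.card := by exact_mod_cast Finset.card_pos.2 hΛ
  have h := real_exists_dense_mul_le_pairSum p Λ hδ.le
  rw [le_div_iff₀ (by positivity), le_div_iff₀ (by positivity)]
  linarith

/-- **The residual stub is implied by the crux** (kernel-checked direction of the equivalence
"`stub_corridor` ⟺ `FreeBoxSparse` modulo the three provable stubs"): if `FreeBoxSparse` holds then the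
registered signature of `stub_corridor` (line `ccfs-window-kissing-walls`) holds, with `r = 0`, `σ = 1`:
`P(Λ_n has a δ-dense free piece) ≤ FA₂(p_c, n)/δ² → 0` (`real_exists_dense_le_pairAverage_div`), so for
`ε < 1` the giant-scale hypothesis `1 - ε ≤ P(BothDense)` fails eventually, and for `ε ≥ 1` the conclusion
event (which asks for a dense piece of `Λ_n`) has probability `< ε` eventually. [folklore] -/
theorem stub_corridor_of_freeBoxSparse :
    Summit.CriticalPhenomena.PercolationContinuityZ3.Theses.PercNonProliferation.FreeBoxSparse → (∀ (i : Fin 3) (δ : ℝ), 0 < δ → ∀ ε : ℝ, 0 < ε → ∃ r : ℕ, ∃ σ : ℝ, 0 < σ ∧ ∀ᶠ n : ℕ in atTop, 1 - ε ≤ (bondPercolation (zdGraph 3) (criticalProbI 3)).real {ω | (∃ x ∈ box 3 n, δ * ((box 3 n).card : ℝ) ≤ ((((box 3 n).filter fun v => ω ∈ openConnIn ↑(box 3 n) x v)).card : ℝ)) ∧ (∃ y ∈ ((box 3 n).image (· + (fun j : Fin 3 => if j = i then 2 * (n : ℤ) + 1 else 0))), δ * (((box 3 n).image (· + (fun j :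 Fin 3 => if j = i then 2 * (n : ℤ) + 1 else 0))).card : ℝ) ≤ (((((box 3 n).image (· + (fun j : Fin 3 => if j = i then 2 * (n : ℤ) + 1 else 0))).filter fun v => ω ∈ openConnIn ↑((box 3 n).image (· + (fun j : Fin 3 => if j = i then 2 * (n : ℤ) + 1 else 0))) y v)).card : ℝ))} → (bondPercolation (zdGraph 3) (criticalProbI 3)).real {ω | ∃ x ∈ box 3 n, ∃ y ∈ ((box 3 n).image (· + (fun j : Fin 3 => if j = i then 2 * (n : ℤ) + 1 else 0))), (∀ x' ∈ box 3 n, (((box 3 n).filter fun v => ω ∈ openConnIn ↑(box 3 n) x' v)).card ≤ (((box 3 n).filter fun v => ω ∈ openConnIn ↑(box 3 n) x v)).card) ∧ (∀ y' ∈ ((box 3 n).image (· + (fun j : Fin 3 => if j = i then 2 * (n : ℤ) + 1 else 0))), ((((box 3 n).image (· + (fun j : Fin 3 => if j = i then 2 * (n : ℤ) + 1 else 0))).filter fun v => ω ∈ openConnIn ↑((box 3 n).image (· + (fun j : Fin 3 => if j = i then 2 * (n : ℤ) + 1 else 0))) y' v)).card ≤ ((((box 3 n).image (· + (fun j : Fin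 3 => if j = i then 2 * (n : ℤ) + 1 else 0))).filter fun v => ω ∈ openConnIn ↑((box 3 n).image (· + (fun j : Fin 3 => if j = i then 2 * (n : ℤ) + 1 else 0))) y v)).card) ∧ δ * ((box 3 n).card : ℝ) ≤ ((((box 3 n).filter fun v => ω ∈ openConnIn ↑(box 3 n) x v)).card : ℝ) ∧ δ * (((box 3 n).image (· + (fun j : Fin 3 => if j = i then 2 * (n : ℤ) + 1 else 0))).card : ℝ) ≤ (((((box 3 n).image (· + (fun j : Fin 3 => if j = i then 2 * (n : ℤ) + 1 else 0))).filter fun v => ω ∈ openConnIn ↑((box 3 n).image (· + (fun j : Fin 3 => if j = i then 2 * (n : ℤ) + 1 else 0))) y v)).card : ℝ) ∧ ω ∉ openConnIn ↑(box 3 n ∪ ((box 3 n).image (· + (fun j : Fin 3 => if j = i then 2 * (n : ℤ) + 1 else 0)))) x y ∧ (Set.ncard {a : Site 3 | a ∈ (box 3 n ∪ ((box 3 n).image (· + (fun j : Fin 3 => if j = i then 2 * (n : ℤ) + 1 else 0)))) ∧ (box 3 r).image (· + a) ⊆ (box 3 n ∪ ((box 3 n).image (· + (fun j : Fin 3 =>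 if j = i then 2 * (n : ℤ) + 1 else 0)))) ∧ (∃ u ∈ (box 3 n ∪ ((box 3 n).image (· + (fun j : Fin 3 => if j = i then 2 * (n : ℤ) + 1 else 0)))), (Finset.univ.sup fun j : Fin 3 => (u j - a j).natAbs) ≤ r ∧ ω ∈ openConnIn ↑(box 3 n ∪ ((box 3 n).image (· + (fun j : Fin 3 => if j = i then 2 * (n : ℤ) + 1 else 0)))) x u) ∧ (∃ u ∈ (box 3 n ∪ ((box 3 n).image (· + (fun j : Fin 3 => if j = i then 2 * (n : ℤ) + 1 else 0)))), (Finset.univ.sup fun j : Fin 3 => (u j - a j).natAbs) ≤ r ∧ ω ∈ openConnIn ↑(box 3 n ∪ ((box 3 n).image (· + (fun j : Fin 3 => if j = i then 2 * (n : ℤ) + 1 else 0)))) y u)} : ℝ) < (((box 3 n ∪ ((box 3 n).image (· + (fun j : Fin 3 => if j = i then 2 * (n : ℤ) + 1 else 0)))).card : ℝ)) ^ ((1 : ℝ) / 2 + σ)} < ε) := by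
  intro hS i δ hδ ε hε
  refine ⟨0, 1, one_pos, ?_⟩
  -- the dense-piece probability of `Λ_n` tends to `0`
  set q : ℕ → ℝ := fun n => (bondPercolation (zdGraph 3) (criticalProbI 3)).real {ω | ∃ x ∈ box 3 n,
      δ * ((box 3 n).card : ℝ) ≤ ((((box 3 n).filter fun v => ω ∈ openConnIn ↑(box 3 n) x v)).card : ℝ)} with hq
  have hq0 : Tendsto q atTop (𝓝 0) := by
    have hup : ∀ n, q n ≤ ((∑ x ∈ box 3 n, ∑ y ∈ box 3 n,
        (bondPercolation (zdGraph 3) (criticalProbI 3)).real (openConnIn (↑(box 3 n) : Set (Site 3)) x y)) /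
          (((box 3 n).card : ℝ)) ^ 2) / δ ^ 2 :=
      fun n => real_exists_dense_le_pairAverage_div (criticalProbI 3) (box_nonempty 3 n) hδ
    have hlim : Tendsto (fun n : ℕ => ((∑ x ∈ box 3 n, ∑ y ∈ box 3 n,
        (bondPercolation (zdGraph 3) (criticalProbI 3)).real (openConnIn (↑(box 3 n) : Set (Site 3)) x y)) /
          (((box 3 n).card : ℝ)) ^ 2) / δ ^ 2) atTop (𝓝 0) := by
      simpa using hS.div_const (δ ^ 2)
    exact squeeze_zero (fun n => measureReal_nonneg) hup hlim
  by_cases hε1 : ε < 1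
  · filter_upwards [hq0.eventually (gt_mem_nhds (sub_pos.2 hε1))] with n hn hhyp
    exfalso
    have hle : (bondPercolation (zdGraph 3) (criticalProbI 3)).real
        {ω | (∃ x ∈ box 3 n, δ * ((box 3 n).card : ℝ) ≤ ((((box 3 n).filter fun v => ω ∈ openConnIn ↑(box 3 n) x v)).card : ℝ)) ∧
          (∃ y ∈ ((box 3 n).image (· + (fun j : Fin 3 => if j = i then 2 * (n : ℤ) + 1 else 0))),
            δ * (((box 3 n).image (· + (fun j : Fin 3 => if j = i then 2 * (n : ℤ) + 1 else 0))).card : ℝ) ≤ (((((box 3 n).image (· + (fun j : Fin 3 => if j = i then 2 * (n : ℤ) + 1 else 0))).filter fun v => ω ∈ openConnIn ↑((box 3 n).image (· + (fun j : Fin 3 => if j = i then 2 * (n : ℤ) + 1 else 0))) y v)).card : ℝ))}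
        ≤ q n := measureReal_mono fun ω hω => hω.1
    linarith
  · filter_upwards [hq0.eventually (gt_mem_nhds hε)] with n hn _hhyp
    refine lt_of_le_of_lt (le_trans (measureReal_mono fun ω hω => ?_) le_rfl) hn
    obtain ⟨x, hx, y, _hy, _hmx, _hmy, hdx, _⟩ := hω
    exact ⟨x, hx, hdx⟩

end Summit.CriticalPhenomena.PercolationContinuityZ3.Theorems.FreeBoxSparse

end
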